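import Summits.CriticalPhenomena.SAWScalingLimit.Theorems.SAWLoopFugacityFlowIsingBoundaryRatioWindowCrossingCells
import Summits.CriticalPhenomena.SAWScalingLimit.Theorems.SAWLoopFugacityFlowIsingBoundaryRatioWindowRectSquares
import Literature.Probability.LatticeModels.SquareTilingConjugate
import HarnessLib

/-!
# Chains of squares along a path avoiding the edges of `E`
(line `fk-anchor-transfer`, crux `IsingBoundaryRatio`, stmt-CriticalPhenomena-10650; helper file of the stub
`windowRectPresentation_holds`)

**Theorem** (`stepChain_of_path`). Let `E` be a finite set of lattice edges drawn at mesh `δ > 0` and let `γ`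
be a path in the plane avoiding the closed segments of the edges of `E`. Then any two closed unit squares of the
mesh meeting the range of `γ` are joined by a chain of closed squares meeting the range of `γ`, consecutive
squares being side-adjacent across a side that is NOT an edge of `E` (the step relation of the non-interleaving
theorem `…WindowRectNonInterleave2` and of the hole-filling of `…WindowRectEdgeSet`).

Proof: the closed squares containing a given point `z` off the edges of `E` are pairwise so joined through
squares containing `z` (one square; or two squares sharing a side through `z`; or four squares round the lattice
point `z`, whose four edges are not in `E` as they contain `z`), and the parameter interval is connected
(`forall_of_path_cover`). The closed squares are those of `SquareTilingConjugate.lean` (`SquareTiling.closedSq`).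
[folklore]
-/

noncomputable section

open scoped Classical
open Set Complex Literature.Probability.LatticeModels Literature.Probability.LatticeModels.DiscreteRect
  Literature.Probability.LatticeModels.SquareTiling

namespace Summit.CriticalPhenomena.SAWScalingLimit.Theorems.IsingBoundaryRatio

namespace WindowRect

variable {δ : ℝ} {E : Finset (Sym2 (Site 2))}

/-! ### Closed squares -/

/-- Membership in a closed square (`SquareTiling.closedSq`), unfolded. [folklore] -/
theorem mem_closedSq_iff' {g : Site 2} {z : ℂ} :
    z ∈ closedSq δ g ↔ δ * g 0 ≤ z.re ∧ z.re ≤ δ * (g 0 + 1) ∧ δ * g 1 ≤ z.im ∧ z.im ≤ δ * (g 1 + 1) := Iff.rfl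

/-- A point of a bounded set lies in a closed square with bounded corner. [folklore] -/
theorem abs_le_of_mem_closedSq (hδ : 0 < δ) {R : ℝ} {z : ℂ} (hz : ‖z‖ ≤ R) {g : Site 2} (hg : z ∈ closedSq δ g) :
    |(g 0 : ℝ)| ≤ R / δ + 1 ∧ |(g 1 : ℝ)| ≤ R / δ + 1 := by
  obtain ⟨a1, a2, a3, a4⟩ := hg
  have hre := (abs_re_le_norm z).trans hz
  have him := (abs_im_le_norm z).trans hz
  rw [abs_le] at hre him ⊢
  rw [abs_le]
  have hRδ : R / δ * δ = R := div_mul_cancel₀ R hδ.ne'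
  constructor <;> constructor <;> nlinarith

/-- The side segment of a square lies in its closed square. [folklore] -/
theorem segment_side_subset_closedSq (hδ : 0 < δ) (g : Site 2) (i : Fin 4) :
    segment ℝ (meshPoint δ (corner g i)) (meshPoint δ (corner g i + dir i)) ⊆ closedSq δ g := by
  intro z hz
  obtain ⟨h0, h0', h1, h1'⟩ := re_im_bounds_of_mem_segment hδ hz
  rw [mem_closedSq_iff']
  fin_cases i <;> simp [corner, dir] at h0 h0' h1 h1' <;> refine ⟨?_, ?_, ?_, ?_⟩ <;> linarith

/-- Two closed squares with a common point have corners at sup-distance `≤ 1`. [folklore] -/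
theorem near_of_mem_closedSq (hδ : 0 < δ) {g g' : Site 2} {z : ℂ} (hg : z ∈ closedSq δ g) (hg' : z ∈ closedSq δ g') :
    g' 0 ≤ g 0 + 1 ∧ g 0 ≤ g' 0 + 1 ∧ g' 1 ≤ g 1 + 1 ∧ g 1 ≤ g' 1 + 1 := by
  obtain ⟨a1, a2, a3, a4⟩ := hg
  obtain ⟨b1, b2, b3, b4⟩ := hg'
  have h0 : ((g' 0 : ℤ) : ℝ) ≤ g 0 + 1 := le_of_mul_le_mul_left (b1.trans a2) hδ
  have h0' : ((g 0 : ℤ) : ℝ) ≤ g' 0 + 1 := le_of_mul_le_mul_left (a1.trans b2) hδ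
  have h1 : ((g' 1 : ℤ) : ℝ) ≤ g 1 + 1 := le_of_mul_le_mul_left (b3.trans a4) hδ
  have h1' : ((g 1 : ℤ) : ℝ) ≤ g' 1 + 1 := le_of_mul_le_mul_left (a3.trans b4) hδ
  exact ⟨by exact_mod_cast h0, by exact_mod_cast h0', by exact_mod_cast h1, by exact_mod_cast h1'⟩

/-! ### Steps across sides through a common point -/

/-- An axis point `framePt δ (v, K) t 0`, `0 ≤ t ≤ δ`, lies on the closed segment of the edge `v, v + e_K`.
[folklore] -/
theorem framePt_axis_mem_segment' (hδ : 0 < δ) (v : Site 2) (K : Fin 4) {t : ℝ} (ht : t ∈ Icc 0 δ) :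
    framePt δ (v, K) t 0 ∈ segment ℝ (meshPoint δ v) (meshPoint δ (v + dir K)) := by
  rw [← framePt_origin v K, ← framePt_far v K, segment_eq_image_lineMap]
  refine ⟨t / δ, ⟨div_nonneg ht.1 hδ.le, (div_le_one hδ).2 ht.2⟩, ?_⟩
  rw [framePt_lineMap_fst]; congr 1
  · field_simp
    ring

/-- **One step.** If the common point `z` (off the edges of `E`) is an axis point of the `i`-th side of the
square `g`, and both `g` and the square across are in `𝒞`, they are related by a step inside `𝒞`. [folklore] -/
theorem step_of_axisPt (hδ : 0 < δ) {𝒞 : Set (Site 2)} {g : Site 2}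
    {i : Fin 4} {z : ℂ} (havoid : ∀ v w : Site 2, s(v, w) ∈ E → z ∉ segment ℝ (meshPoint δ v) (meshPoint δ w))
    {t : ℝ} (ht : t ∈ Icc 0 δ) (hz : z = framePt δ (corner g i, i) t 0) (hg : g ∈ 𝒞) (hq : g + dir (i + 3) ∈ 𝒞) :
    (g ∈ 𝒞 ∧ g + dir (i + 3) ∈ 𝒞 ∧ ∃ j : Fin 4, g + dir (i + 3) = g + dir (j + 3) ∧
      s(corner g j, corner g j + dir j) ∉ E) := by
  refine ⟨hg, hq, i, rfl, fun hmem => havoid _ _ hmem ?_⟩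
  rw [hz]
  exact framePt_axis_mem_segment' hδ (corner g i) i ht

/-- **Horizontal neighbours through a common point** are related by steps through squares containing the
point. [folklore] -/
theorem steps_horizontal (hδ : 0 < δ) {z : ℂ}
    (havoid : ∀ v w : Site 2, s(v, w) ∈ E → z ∉ segment ℝ (meshPoint δ v) (meshPoint δ w))
    {g g' : Site 2} (hg : z ∈ closedSq δ g) (hg' : z ∈ closedSq δ g') (h1 : g' 1 = g 1)
    (h0 : g' 0 = g 0 + 1 ∨ g' 0 = g 0 - 1) :
    Relation.ReflTransGen (fun p q : Site 2 => p ∈ {a | z ∈ closedSq δ a} ∧ q ∈ {a | z ∈ closedSq δ a} ∧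
      ∃ j : Fin 4, q = p + dir (j + 3) ∧ s(corner p j, corner p j + dir j) ∉ E) g g' := by
  obtain ⟨a1, a2, a3, a4⟩ := hg
  obtain ⟨b1, b2, b3, b4⟩ := hg'
  rcases h0 with h0 | h0
  · -- across the right side (index `1`)
    have hq : g' = g + dir (1 + 3) := by
      rw [Site.eq_iff_two]; simp [dir, h0, h1]
    have hre : z.re = δ * (g 0 + 1) := by
      rw [h0] at b1; push_cast at b1; linarith
    have hz : z = framePt δ (corner g 1, 1) (z.im - δ * g 1) 0 := by
      apply Complex.ext
      all_goals simp [framePt, corner, dir, meshPoint]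
      all_goals linarith
    rw [hq]
    refine Relation.ReflTransGen.single (step_of_axisPt hδ havoid ⟨by linarith, by linarith⟩ hz
      ⟨a1, a2, a3, a4⟩ ?_)
    rw [← hq]; exact ⟨b1, b2, b3, b4⟩
  · -- across the left side (index `3`)
    have hq : g' = g + dir (3 + 3) := by
      rw [show (3 : Fin 4) + 3 = 2 from rfl, Site.eq_iff_two]; simp [dir, h0, h1]; ring
    have hre : z.re = δ * g 0 := by
      rw [h0] at b2; push_cast at b2; linarith
    have hz : z = framePt δ (corner g 3, 3) (δ * (g 1 + 1) - z.im) 0 := by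
      apply Complex.ext
      all_goals simp [framePt, corner, dir, meshPoint]
      all_goals linarith
    rw [hq]
    refine Relation.ReflTransGen.single (step_of_axisPt hδ havoid ⟨by linarith, by linarith⟩ hz
      ⟨a1, a2, a3, a4⟩ ?_)
    rw [← hq]; exact ⟨b1, b2, b3, b4⟩

/-- **Vertical neighbours through a common point** are related by steps through squares containing the point.
[folklore] -/
theorem steps_vertical (hδ : 0 < δ) {z : ℂ}
    (havoid : ∀ v w : Site 2, s(v, w) ∈ E → z ∉ segment ℝ (meshPoint δ v) (meshPoint δ w))
    {g g' : Site 2} (hg : z ∈ closedSq δ g) (hg' : z ∈ closedSq δ g') (h0 : g' 0 = g 0)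
    (h1 : g' 1 = g 1 + 1 ∨ g' 1 = g 1 - 1) :
    Relation.ReflTransGen (fun p q : Site 2 => p ∈ {a | z ∈ closedSq δ a} ∧ q ∈ {a | z ∈ closedSq δ a} ∧
      ∃ j : Fin 4, q = p + dir (j + 3) ∧ s(corner p j, corner p j + dir j) ∉ E) g g' := by
  obtain ⟨a1, a2, a3, a4⟩ := hg
  obtain ⟨b1, b2, b3, b4⟩ := hg'
  rcases h1 with h1 | h1
  · -- across the top side (index `2`)
    have hq : g' = g + dir (2 + 3) := by
      rw [Site.eq_iff_two]; simp [dir, h0, h1]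
    have him : z.im = δ * (g 1 + 1) := by
      rw [h1] at b3; push_cast at b3; linarith
    have hz : z = framePt δ (corner g 2, 2) (δ * (g 0 + 1) - z.re) 0 := by
      apply Complex.ext
      all_goals simp [framePt, corner, dir, meshPoint]
      all_goals linarith
    rw [hq]
    refine Relation.ReflTransGen.single (step_of_axisPt hδ havoid ⟨by linarith, by linarith⟩ hz
      ⟨a1, a2, a3, a4⟩ ?_)
    rw [← hq]; exact ⟨b1, b2, b3, b4⟩
  · -- across the bottom side (index `0`)
    have hq : g' = g + dir (0 + 3) := by
      rw [show (0 : Fin 4) + 3 = 3 from rfl, Site.eq_iff_two]; simp [dir, h0, h1]; ring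
    have him : z.im = δ * g 1 := by
      rw [h1] at b4; push_cast at b4; linarith
    have hz : z = framePt δ (corner g 0, 0) (z.re - δ * g 0) 0 := by
      apply Complex.ext
      all_goals simp [framePt, corner, dir, meshPoint]
      all_goals linarith
    rw [hq]
    refine Relation.ReflTransGen.single (step_of_axisPt hδ havoid ⟨by linarith, by linarith⟩ hz
      ⟨a1, a2, a3, a4⟩ ?_)
    rw [← hq]; exact ⟨b1, b2, b3, b4⟩

/-- **Any two closed squares containing a point off the edges of `E` are joined through squares containing the
point.** [folklore] -/
theorem steps_of_mem_closedSq (hδ : 0 < δ) {z : ℂ}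
    (havoid : ∀ v w : Site 2, s(v, w) ∈ E → z ∉ segment ℝ (meshPoint δ v) (meshPoint δ w))
    {g g' : Site 2} (hg : z ∈ closedSq δ g) (hg' : z ∈ closedSq δ g') :
    Relation.ReflTransGen (fun p q : Site 2 => p ∈ {a | z ∈ closedSq δ a} ∧ q ∈ {a | z ∈ closedSq δ a} ∧
      ∃ j : Fin 4, q = p + dir (j + 3) ∧ s(corner p j, corner p j + dir j) ∉ E) g g' := by
  obtain ⟨n0, n0', n1, n1'⟩ := near_of_mem_closedSq hδ hg hg'
  -- the intermediate square `(g' 0, g 1)` contains `z`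
  set g'' : Site 2 := ![g' 0, g 1] with hg''
  have hmem'' : z ∈ closedSq δ g'' := by
    obtain ⟨a1, a2, a3, a4⟩ := hg
    obtain ⟨b1, b2, b3, b4⟩ := hg'
    refine ⟨?_, ?_, ?_, ?_⟩ <;> simp only [hg'', Matrix.cons_val_zero, Matrix.cons_val_one] <;> assumption
  have step1 : Relation.ReflTransGen (fun p q : Site 2 => p ∈ {a | z ∈ closedSq δ a} ∧ q ∈ {a | z ∈ closedSq δ a} ∧
      ∃ j : Fin 4, q = p + dir (j + 3) ∧ s(corner p j, corner p j + dir j) ∉ E) g g'' := by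
    rcases (show g' 0 = g 0 ∨ g' 0 = g 0 + 1 ∨ g' 0 = g 0 - 1 by omega) with h | h
    · have : g'' = g := by rw [Site.eq_iff_two]; simp [hg'', h]
      rw [this]
    · exact steps_horizontal hδ havoid hg hmem'' (by simp [hg'']) (by simpa [hg''] using h)
  have step2 : Relation.ReflTransGen (fun p q : Site 2 => p ∈ {a | z ∈ closedSq δ a} ∧ q ∈ {a | z ∈ closedSq δ a} ∧
      ∃ j : Fin 4, q = p + dir (j + 3) ∧ s(corner p j, corner p j + dir j) ∉ E) g'' g' := by
    rcases (show g' 1 = g 1 ∨ g' 1 = g 1 + 1 ∨ g' 1 = g 1 - 1 by omega) with h | h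
    · have : g'' = g' := by rw [Site.eq_iff_two]; simp [hg'', h]
      rw [this]
    · exact steps_vertical hδ havoid hmem'' hg' (by simp [hg'']) (by simpa [hg''] using h)
  exact step1.trans step2

/-! ### Along a path -/

/-- **Chains of squares along a path off the edges of `E`.** Two closed squares meeting the range of a path
that avoids the closed segments of the edges of `E` are joined by steps, through squares meeting the range,
across sides not in `E`. [folklore] -/
theorem stepChain_of_path (hδ : 0 < δ) {x y : ℂ} (γ : Path x y)
    (havoid : ∀ t, ∀ v w : Site 2, s(v, w) ∈ E → γ t ∉ segment ℝ (meshPoint δ v) (meshPoint δ w))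
    {g g' : Site 2} (hg : (closedSq δ g ∩ range γ).Nonempty) (hg' : (closedSq δ g' ∩ range γ).Nonempty) :
    Relation.ReflTransGen (fun p q : Site 2 => p ∈ {a | (closedSq δ a ∩ range γ).Nonempty} ∧
      q ∈ {a | (closedSq δ a ∩ range γ).Nonempty} ∧
      ∃ j : Fin 4, q = p + dir (j + 3) ∧ s(corner p j, corner p j + dir j) ∉ E) g g' := by
  -- a finite set of squares covering the range
  obtain ⟨R, hR⟩ := (isCompact_range γ.continuous).isBounded.subset_closedBall 0
  obtain ⟨B, hB⟩ : ∃ B : ℕ, R / δ + 1 ≤ B := exists_nat_ge _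
  set box : Finset (Site 2) := (Finset.Icc (-(B : ℤ)) B ×ˢ Finset.Icc (-(B : ℤ)) B).image
    fun p => ![p.1, p.2] with hbox
  have hmem_box : ∀ a : Site 2, (closedSq δ a ∩ range γ).Nonempty → a ∈ box := by
    rintro a ⟨z, hza, hzγ⟩
    have hz : ‖z‖ ≤ R := by simpa using hR hzγ
    obtain ⟨h0, h1⟩ := abs_le_of_mem_closedSq hδ hz hza
    rw [abs_le] at h0 h1
    have u0 : ((a 0 : ℤ) : ℝ) ≤ ((B : ℤ) : ℝ) := by push_cast; linarith [h0.2]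
    have l0 : ((-(B : ℤ) : ℤ) : ℝ) ≤ ((a 0 : ℤ) : ℝ) := by push_cast; linarith [h0.1]
    have u1 : ((a 1 : ℤ) : ℝ) ≤ ((B : ℤ) : ℝ) := by push_cast; linarith [h1.2]
    have l1 : ((-(B : ℤ) : ℤ) : ℝ) ≤ ((a 1 : ℤ) : ℝ) := by push_cast; linarith [h1.1]
    have i0 : -(B : ℤ) ≤ a 0 ∧ a 0 ≤ B := ⟨Int.cast_le.1 l0, Int.cast_le.1 u0⟩
    have i1 : -(B : ℤ) ≤ a 1 ∧ a 1 ≤ B := ⟨Int.cast_le.1 l1, Int.cast_le.1 u1⟩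
    refine Finset.mem_image.2 ⟨(a 0, a 1), Finset.mem_product.2 ⟨Finset.mem_Icc.2 i0, Finset.mem_Icc.2 i1⟩, ?_⟩
    rw [Site.eq_iff_two]; simp
  -- propagation
  set S : Set (Site 2) := {a | Relation.ReflTransGen (fun p q : Site 2 => p ∈ {a | (closedSq δ a ∩ range γ).Nonempty} ∧
      q ∈ {a | (closedSq δ a ∩ range γ).Nonempty} ∧
      ∃ j : Fin 4, q = p + dir (j + 3) ∧ s(corner p j, corner p j + dir j) ∉ E) g a} with hS
  refine forall_of_path_cover γ box (closedSq δ) (fun a _ => SquareTiling.isClosed_closedSq δ a)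
    (fun z hz => mem_iUnion₂.2 ⟨_, hmem_box _ ⟨z, mem_closedSq_floorSq hδ z, hz⟩, mem_closedSq_floorSq hδ z⟩) S
    ⟨g, hmem_box g hg, Relation.ReflTransGen.refl, hg⟩ ?_ g' (hmem_box g' hg') hg'
  rintro a - haS a' - ⟨z, ⟨hza, hza'⟩, t, rfl⟩
  have hloc := steps_of_mem_closedSq hδ (havoid t) hza hza'
  refine haS.trans (Relation.ReflTransGen.mono (fun p q h => ?_) _ _ hloc)
  obtain ⟨hp, hq, j, hj, hne⟩ := h
  exact ⟨⟨γ t, hp, t, rfl⟩, ⟨γ t, hq, t, rfl⟩, j, hj, hne⟩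

end WindowRect

/-- **Chains of squares along a path off the edges of `E`**, closed form (registered sub-goal of
stmt-CriticalPhenomena-10650). [folklore] -/
theorem windowRect_stepChain_of_path : ∀ {δ : ℝ} {E : Finset (Sym2 (Site 2))}, 0 < δ → ∀ {x y : ℂ} (γ : Path x y), (∀ t, ∀ v w : Site 2, s(v, w) ∈ E → γ t ∉ segment ℝ (meshPoint δ v) (meshPoint δ w)) → ∀ {g g' : Site 2}, (Literature.Probability.LatticeModels.SquareTiling.closedSq δ g ∩ Set.range γ).Nonempty → (Literature.Probability.LatticeModels.SquareTiling.closedSq δ g' ∩ Set.range γ).Nonempty → Relation.ReflTransGen (fun p q : Site 2 => p ∈ {a | (Literature.Probability.LatticeModels.SquareTiling.closedSq δ a ∩ Set.range γ).Nonempty} ∧ q ∈ {a | (Literature.Probability.LatticeModels.SquareTiling.closedSq δ a ∩ Set.range γ).Nonempty} ∧ ∃ j : Fin 4, q = p + DiscreteRect.dir (j + 3) ∧ s(DiscreteRect.corner p j, DiscreteRect.corner p j + DiscreteRect.dir j) ∉ E) g g' :=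
  fun hδ _ _ γ havoid _ _ hg hg' => WindowRect.stepChain_of_path hδ γ havoid hg hg'

end Summit.CriticalPhenomena.SAWScalingLimit.Theorems.IsingBoundaryRatio

end
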